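import Mathlib
import Summits.Langlands.Langlands.Theses.PicardMuOrdinary
import Summits.Langlands.Langlands.Theorems.PicardMuOrdinaryMuOrdinaryFamilyRTPicardInput
import Literature.NumberTheory.GaloisRepresentations.PicardCurveGaloisRep
import Literature.NumberTheory.GaloisRepresentations.CubicResidueSymbol
import Literature.NumberTheory.GaloisRepresentations.GaloisRep
import Literature.NumberTheory.Automorphic.ReciprocityGLnProofs
import Literature.NumberTheory.GaloisRepresentations.FramedRepTwist
import Literature.NumberTheory.GaloisRepresentations.WeilLAdicCharacterProofs
import Literature.NumberTheory.GaloisRepresentations.ArtinCharacterReciprocity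
import Literature.NumberTheory.GaloisRepresentations.EisensteinPrimaryHeckeCharacter
import Literature.NumberTheory.GaloisRepresentations.AbsIrreducibleIndexTwo
import Literature.NumberTheory.Automorphic.BCDTTheoremBNormalisedAssembly
import HarnessLib

/-!
# The Galois input of line `split-ramified-prime-sqrt6`: primary generators and the CM-twisted
# Picard representation `ρ'_C = ρ_C ⊗ ψ` through `(ι, e)`

Stub `stub_twistedPicardGaloisInput` of the line `split-ramified-prime-sqrt6` for the crux
`Summit.Langlands.Langlands.Theses.PicardMuOrdinary.IrregularClassicality` (stmt-Langlands-13758),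
registered (reshape r3) with the tree's named fact
`Literature.NumberTheory.GaloisRepresentations.picardCurve_exists_lambdaAdicRep` — the untwisted
`λ`-adic representation `ρ_C` of the Picard curve `C_f : y³ = f(x)` through ANY `j : K →+* ℚ̄₃`,
unramified with geometric-Frobenius trace `j(a_𝔭 f)` at every `𝔭 ∤ 3` where `f mod 𝔭` is a
separable quartic, and absolutely irreducible when `12 ∣ #Gal(f)` — as its leading hypothesis.
Everything else is PROVED here, from landed Literature files.

Notation: `K = ℚ(ω) = CyclotomicField 3 ℚ`, `𝓞 K = ℤ[ω]`, `λ = (1 - ω)`, `ℚ̄₃ = PadicAlgCl 3`,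
`a_𝔭(f) = picardTrace f 𝔭`.

Proof.
* **the bad set** `S₀ := badPrimes f = {𝔭 ∋ 3 · a₄ · Res(f, f')}` of the sibling crux
  (`Summits/…/PicardMuOrdinaryMuOrdinaryFamilyRTPicardInput`): it contains every `𝔭 ∣ 3`
  (`mem_badPrimes_of_three_mem`), and off it `f mod 𝔭` is a separable quartic
  (`natDegree_reduction_eq`, `separable_reduction`), so the fact applies at every `𝔭 ∉ S₀`;
* **primary generators** (`Literature/…/EisensteinPrimaryHeckeCharacter`,
  `exists_primaryGen_heckeCharacter_cyclotomicField_three`): every `𝔭 ∤ 3` has a generator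
  `ϖ_𝔭 ≡ 1 mod 3`, and `𝔭 ↦ e(ϖ_𝔭)` is the local value of an ALGEBRAIC Hecke character `ψ` of `K`
  unramified outside `3`;
* **the CM character `3`-adically**: by the tree's proof of Weil's theorem
  (`HeckeCharacter.IsAlgebraic.exists_lAdic`) `ψ` has a `3`-adic avatar `r : Γ_K → GL₁(ℚ̄₃)` through
  `ι`, unramified at `𝔭 ∤ 3` with `r(Frob_𝔭) = ι⁻¹(e(ϖ_𝔭))⁻¹` (arithmetic normalisation,
  `FramedGaloisRep.hasFrobCharpolyAt_iff_of_rank_one`); `χ := det r`;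
* **the twist** `ρ := ρ_C ⊗ χ` (`FramedRep.twist`) of the fact's `ρ_C` through `j = ι⁻¹ ∘ e`:
  unramified off `S₀` with GEOMETRIC Frobenius trace
  `χ(Frob⁻¹) · tr ρ_C(Frob⁻¹) = ι⁻¹(e(ϖ_𝔭)) · ι⁻¹(e(a_𝔭 f)) = ι⁻¹(e(a_𝔭(f) ϖ_𝔭))`;
* **absolute irreducibility on every quadratic `Γ_L`** (`Literature/…/AbsIrreducibleIndexTwo`):
  `ρ_C` absolutely irreducible (the fact, `12 ∣ #Gal(f)`) ⟹ `ρ_C|_{Γ_L}` absolutely irreducible for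
  `[L:K] = 2` because the rank `3` is ODD (`IsAbsolutelyIrreducible.restrictField_of_finrank_eq_two`)
  ⟹ the twist `ρ|_{Γ_L} = ρ_C|_{Γ_L} ⊗ χ|_{Γ_L}` (`restrictField_twist`) is absolutely irreducible
  (`FramedRep.isAbsolutelyIrreducible_twist_iff`).
-/

open Literature.NumberTheory.GaloisRepresentations Literature.NumberTheory.Automorphic
open IsDedekindDomain NumberField Polynomial

set_option linter.dupNamespace false -- project-wide option; `Summit.Langlands.Langlands` is the mandated namespace

noncomputable section

namespace Summit.Langlands.Langlands.Theorems.IrregularClassicality.SplitRamifiedPrimeSqrt6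

/-- **Stub 2 of line `split-ramified-prime-sqrt6`** (registered form, reshape r3: conditional on the
tree's named fact `picardCurve_exists_lambdaAdicRep`, its leading hypothesis).  For a
separable quartic `f ∈ ℤ[X]` with `12 ∣ #Gal(f)`, any `ι : ℚ̄₃ ≃+* ℂ` and `e : K = ℚ(ω) →+* ℂ`: a finite
`S₀ ⊇ {v ∣ 3}` (the bad set `badPrimes` of the model `y³ = f(x)`), PRIMARY GENERATORS `ϖ_𝔭` off `S₀`
(`𝔭 = (ϖ_𝔭)`, `ϖ_𝔭 ≡ 1 mod 3`), and the continuous `ρ = ρ_C ⊗ ψ_{ι,e} : Γ_K → GL₃(ℚ̄₃)` — `ρ_C` the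
fact's Picard representation through `j = ι⁻¹ ∘ e`, `ψ_{ι,e} = det r` for Weil's `3`-adic avatar `r`
of the algebraic Hecke character `ψ` of `K` with `ψ(ϖ_𝔭) = e(ϖ_𝔭)`
(`exists_primaryGen_heckeCharacter_cyclotomicField_three`, `HeckeCharacter.IsAlgebraic.exists_lAdic`)
— which off `S₀` is unramified with geometric Frobenius trace `ι⁻¹(e(a_𝔭(f) · ϖ_𝔭))`, and whose
restriction to `Γ_L` is absolutely irreducible for every quadratic `L/K` (absolute irreducibility of
`ρ_C` descends to the index-`2` subgroup `Γ_L` because the rank `3` is odd, and survives the twist: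
`IsAbsolutelyIrreducible.restrictField_of_finrank_eq_two`, `FramedRep.isAbsolutelyIrreducible_twist_iff`). -/
theorem stub_twistedPicardGaloisInput :
    Literature.NumberTheory.GaloisRepresentations.picardCurve_exists_lambdaAdicRep →
    ∀ (f : ℤ[X]), f.natDegree = 4 → (f.map (Int.castRingHom ℚ)).Separable →
      12 ∣ Nat.card (f.map (Int.castRingHom ℚ)).Gal →
    ∀ (ι : PadicAlgCl 3 ≃+* ℂ) (e : CyclotomicField 3 ℚ →+* ℂ),
    ∃ (S₀ : Finset (HeightOneSpectrum (𝓞 (CyclotomicField 3 ℚ))))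
      (ϖ : HeightOneSpectrum (𝓞 (CyclotomicField 3 ℚ)) → 𝓞 (CyclotomicField 3 ℚ))
      (ρ : FramedGaloisRep (CyclotomicField 3 ℚ) (PadicAlgCl 3) 3),
      (∀ v : HeightOneSpectrum (𝓞 (CyclotomicField 3 ℚ)),
        ((3 : ℕ) : 𝓞 (CyclotomicField 3 ℚ)) ∈ v.asIdeal → v ∈ S₀) ∧
      (∀ (L : Type) [Field L] [NumberField L] [Algebra (CyclotomicField 3 ℚ) L],
        Module.finrank (CyclotomicField 3 ℚ) L = 2 →
          FramedRep.IsAbsolutelyIrreducible (ρ.restrictField L)) ∧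
      ∀ 𝔭 ∉ S₀,
        (𝔭.asIdeal = Ideal.span {ϖ 𝔭} ∧
          ϖ 𝔭 - 1 ∈ Ideal.span {(3 : 𝓞 (CyclotomicField 3 ℚ))}) ∧
        ρ.IsUnramifiedAt 𝔭 ∧
        ∀ 𝔓 ∈ 𝔭.primesAbove, ∀ τ : Field.absoluteGaloisGroup (CyclotomicField 3 ℚ),
          IsArithFrobAt (𝓞 (CyclotomicField 3 ℚ)) τ 𝔓 →
            FramedRep.trace ρ τ⁻¹ = ι.symm (e (↑(picardTrace f 𝔭 * ϖ 𝔭))) := by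
  intro hC f hdeg hsep hgal ι e
  classical
  -- the primary generators `ϖ` and the algebraic CM character `ψ` with `ψ(ϖ_𝔭) = e(ϖ_𝔭)`
  obtain ⟨ϖ, ψ, hψalg, hϖψ⟩ := exists_primaryGen_heckeCharacter_cyclotomicField_three e
  -- Weil's `3`-adic avatar `r` of `ψ` through `ι`, and the character `χ = det r`
  obtain ⟨r, hr⟩ := HeckeCharacter.IsAlgebraic.exists_lAdic (ℓ := 3) hψalg ι
  let χ : Field.absoluteGaloisGroup (CyclotomicField 3 ℚ) →ₜ* (PadicAlgCl 3)ˣ := FramedRep.det r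
  -- the Picard representation `ρ_C` through `j = ι⁻¹ ∘ e` (the named fact)
  obtain ⟨ρC, hρC, hirrC⟩ := hC f hdeg hsep (ι.symm.toRingHom.comp e)
  -- the level `S₀ = {𝔭 ∋ 3 · a₄ · Res(f, f')} ⊇ {v ∣ 3}` (the sibling crux's `badPrimes`)
  have hS₀ := Cruxes.MuOrdinaryFamilyRT.CharZeroDominance.mem_badPrimes_of_three_mem hdeg hsep
  refine ⟨Cruxes.MuOrdinaryFamilyRT.CharZeroDominance.badPrimes hdeg hsep, ϖ, FramedRep.twist ρC χ,
    hS₀, fun L _ _ _ hL => ?_, fun 𝔭 h𝔭 => ?_⟩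
  · -- absolute irreducibility on `Γ_L`, `[L : K] = 2`
    rw [FramedGaloisRep.restrictField_twist L ρC χ, FramedRep.isAbsolutelyIrreducible_twist_iff]
    exact FramedGaloisRep.IsAbsolutelyIrreducible.restrictField_of_finrank_eq_two (by decide) L hL
      (hirrC hgal)
  · -- primary generator, unramifiedness and the twisted trace at `𝔭 ∉ S₀`
    have h𝔭3 : (3 : 𝓞 (CyclotomicField 3 ℚ)) ∉ 𝔭.asIdeal := fun h =>
      h𝔭 (hS₀ 𝔭 (by rwa [Nat.cast_ofNat]))
    have h𝔭3' : ((3 : ℕ) : 𝓞 (CyclotomicField 3 ℚ)) ∉ 𝔭.asIdeal := by rw [Nat.cast_ofNat]; exact h𝔭3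
    obtain ⟨hgen, hunr, hval⟩ := hϖψ 𝔭 h𝔭3
    obtain ⟨hrunr, hrfrob⟩ := hr 𝔭 h𝔭3' hunr
    obtain ⟨hρunr, hρfrob⟩ := hρC 𝔭 h𝔭3
      (Cruxes.MuOrdinaryFamilyRT.CharZeroDominance.natDegree_reduction_eq hdeg hsep h𝔭)
      (Cruxes.MuOrdinaryFamilyRT.CharZeroDominance.separable_reduction hdeg hsep h𝔭)
    refine ⟨hgen, fun 𝔓 h𝔓 σ hσ => ?_, fun 𝔓 h𝔓 τ hτ => ?_⟩
    · -- inertia: `χ(σ) = det r(σ) = 1` and `ρ_C(σ) = 1`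
      have hχσ : χ σ = 1 := by
        change FramedRep.det r σ = 1
        rw [FramedRep.det_apply, hrunr 𝔓 h𝔓 σ hσ, map_one]
      rw [FramedRep.twist_apply, hρunr 𝔓 h𝔓 σ hσ, mul_one, hχσ, map_one]
    · -- Frobenius: `χ(τ⁻¹) = ι⁻¹(e(ϖ_𝔭))`, `tr ρ_C(τ⁻¹) = ι⁻¹(e(a_𝔭 f))`
      have hχ : (χ τ⁻¹ : PadicAlgCl 3) = ι.symm (e (ϖ 𝔭)) := by
        have h1 := (FramedGaloisRep.hasFrobCharpolyAt_iff_of_rank_one r 𝔭 _).mp hrfrob 𝔓 h𝔓 τ hτ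
        change ((FramedRep.det r τ⁻¹ : (PadicAlgCl 3)ˣ) : PadicAlgCl 3) = _
        rw [FramedRep.det_apply, map_inv, map_inv, Units.val_inv_eq_inv_val,
          Matrix.GeneralLinearGroup.val_det_apply, Matrix.det_fin_one, h1, hval, map_inv₀, inv_inv]
      rw [FramedRep.trace, FramedRep.coe_twist_apply, Matrix.trace_smul, smul_eq_mul, hχ]
      change _ * FramedRep.trace ρC τ⁻¹ = _
      rw [hρfrob 𝔓 h𝔓 τ hτ]
      simp only [RingHom.coe_comp, Function.comp_apply, RingEquiv.toRingHom_eq_coe, RingEquiv.coe_toRingHom,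
        map_mul, mul_comm]

end Summit.Langlands.Langlands.Theorems.IrregularClassicality.SplitRamifiedPrimeSqrt6

end
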